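import Summits.Langlands.Langlands.Theorems.IrreducibilityBySelfDualityReciprocityUpToIrreducibilityAboveUnramified
import Summits.Langlands.Langlands.Theorems.IrreducibilityBySelfDualityVarmaWeilTracesUnramified
import Literature.NumberTheory.Automorphic.LocalLanglandsGLOne
import Literature.NumberTheory.Automorphic.SatakeParameterGenericBoundFlathProofs
import Literature.NumberTheory.Automorphic.WhittakerCoeffLocalDatum
import Literature.NumberTheory.Automorphic.ShintaniWhittakerFormula
import Summits.Langlands.Langlands.Theorems.IrreducibilityBySelfDualityReciprocityUpToIrreducibilityAwayUnramified
import Summits.Langlands.Langlands.Theorems.IrreducibilityBySelfDualityReciprocityUpToIrreducibilityRankOneMatching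
import Literature.NumberTheory.GaloisRepresentations.InertiaCharacter
import Summits.Langlands.Langlands.Theorems.IrreducibilityBySelfDualityReciprocityUpToIrreducibilityRankOneLocalComponent
import HarnessLib

/-!
# Line `Sketch` for the crux `ReciprocityUpToIrreducibility` (item stmt-Langlands-14328), continuation c4:
# rank one — the Galois side of the unramified matching

Support file (closes nothing; continuation lead c4, prover-line-stmt-Langlands-14328-c4-0).

The unramified-sector reduction of the summit's local–global compatibility (c3 `…AboveUnramified`,
c4 `…AwayUnramified`) leaves the ℓ-blind matching `rec_v(π_v) = [ι(ρ|_{W_{K_v}}, 0)^{F-ss}]`.  In rank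
one the Galois side of that matching is computable from the Satake clause: if `ρ : Γ_K → GL₁(ℚ̄_ℓ)` is
unramified at `v` with `char(ρ(Frob_v^{arith})) = X - ι⁻¹(a)⁻¹` (the shape of
`arithFrobPolyOfSatake ι q_v 1 {a}`), then every transport `rℂ` of `(ρ|_{W_{K_v}}, 0)` along `ι` has
`N = 0`, is unramified, and its GEOMETRIC Frobenii act by the scalar `a`
(`rankOne_transport_frobenius`; Frobenius dictionary
`trace_toLocal_eq_of_isUnramifiedAt_of_hasFrobCharpolyAt` of `…VarmaWeilTracesUnramified`, `deg` of a
geometric Frobenius is `-1`).  No definitions; std axioms.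
-/

noncomputable section

set_option linter.dupNamespace false -- project-wide option (lakefile weak.linter.dupNamespace); `Summit.Langlands.Langlands` is the mandated namespace

open scoped MatrixGroups Matrix NumberField Classical Polynomial
open Filter IsDedekindDomain Field Polynomial
open Literature.NumberTheory.Automorphic Literature.NumberTheory.GaloisRepresentations
open Literature.NumberTheory.PAdicHodge
open Summit.Langlands
open Summit.Langlands.Langlands.Theorems.VarmaWeilTracesUnramified

namespace Summit.Langlands.Langlands.Theorems.ReciprocityUpToIrreducibility


section RankOne

variable {K : Type} [Field K] [NumberField K] {ℓ : ℕ} [Fact ℓ.Prime]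

/-- A `1 × 1` matrix is its trace times the identity. [folklore] -/
theorem matrix_fin_one_eq_trace_smul_one {R : Type*} [CommRing R] (M : Matrix (Fin 1) (Fin 1) R) :
    M = M.trace • (1 : Matrix (Fin 1) (Fin 1) R) := by
  ext i j
  fin_cases i; fin_cases j
  simp [Matrix.trace_fin_one]

/-- **Rank one, Galois side of the unramified matching.**  Let `ρ : Γ_K → GL₁(ℚ̄_ℓ)` be unramified at
`v` with `char(ρ(Frob_v^{arith})) = X - ι⁻¹(a)⁻¹` (`a ∈ ℂ`, `a ≠ 0`; this is the Satake clause
`HasFrobCharpolyAt v (arithFrobPolyOfSatake ι q_v 1 {a})` unfolded).  Then every transport `rℂ` of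
`(ρ|_{W_{K_v}}, N = 0)` along `ι` has `N = 0`, is trivial on inertia, and sends every GEOMETRIC
Frobenius `Φ` (`deg Φ = -1`) to the scalar `a`: the restriction of `Φ` to `Γ_K` is the inverse of an
arithmetic Frobenius at the prime of `K̄` under `v` singled out by the completion, so
`ρ(Φ) = (ι⁻¹(a)⁻¹)⁻¹ = ι⁻¹(a)` (`trace_toLocal_eq_of_isUnramifiedAt_of_hasFrobCharpolyAt` with `d = -1`).
[cite: TateCorvallis1979, (4.1.3)–(4.2.1)] [cite: BuzzardGeeLMS2014, Rem. 3.2.5] -/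
theorem rankOne_transport_frobenius (ι : PadicAlgCl ℓ ≃+* ℂ) (ρ : FramedGaloisRep K (PadicAlgCl ℓ) 1)
    (v : HeightOneSpectrum (𝓞 K)) (hρ : ρ.IsUnramifiedAt v) (a : ℂ)
    (hfrob : ρ.HasFrobCharpolyAt v (X - C (ι.symm a)⁻¹))
    (rℂ : WeilDeligneRep (v.adicCompletion K) ℂ (Fin 1 → ℂ))
    (htr : (WeilDeligneRep.ofRep ((ρ.toLocal v).weilRestrict (v.adicCompletion K))
      (isLocallyUnramified_toLocal_of_isUnramifiedAt ρ v hρ).isUnramifiedRep_weilRestrict.isContinuousRep).IsTransportAlong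
        (ι : PadicAlgCl ℓ →+* ℂ) rℂ) :
    rℂ.N = 0 ∧ WeilGroup.IsUnramifiedRep rℂ.ρ ∧
      ∀ Φ : WeilGroup (v.adicCompletion K), WeilGroup.deg Φ = -1 → rℂ.ρ Φ = a • LinearMap.id := by
  refine ⟨htr.N_eq_zero (WeilDeligneRep.ofRep_N _ _),
    htr.isUnramifiedRep
      (isLocallyUnramified_toLocal_of_isUnramifiedAt ρ v hρ).isUnramifiedRep_weilRestrict, fun Φ hΦ => ?_⟩
  -- the Frobenius dictionary: `tr ρ(Φ) = (ι⁻¹ a)⁻¹ ^ (-1) = ι⁻¹ a`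
  have hfrob' : ρ.HasFrobCharpolyAt v ((({(ι.symm a)⁻¹} : Multiset (PadicAlgCl ℓ)).map fun b => X - C b).prod) := by
    simpa using hfrob
  have hdeg : IsFrobPow (WeilGroup.toAbsGalois (v.adicCompletion K) Φ) (-1) := by
    simpa [hΦ] using WeilGroup.isFrobPow_deg IsFrobPow.mul_holds Φ
  have htrace := trace_toLocal_eq_of_isUnramifiedAt_of_hasFrobCharpolyAt v ρ {(ι.symm a)⁻¹} hρ hfrob'
    (WeilGroup.toAbsGalois (v.adicCompletion K) Φ) (-1) hdeg
  have htrace' : (((ρ.toLocal v) (WeilGroup.toAbsGalois (v.adicCompletion K) Φ) : GL (Fin 1) (PadicAlgCl ℓ)) :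
      Matrix (Fin 1) (Fin 1) (PadicAlgCl ℓ)).trace = ι.symm a := by
    rw [htrace]
    simp
  -- the matrix of `rℂ.ρ Φ` is the `ι`-image of that of `ρ(Φ)`, i.e. `a • 1`
  have hmat := htr.1 Φ
  rw [WeilDeligneRep.ofRep_ρ, toMatrix'_weilRestrict] at hmat
  have hM : ((((ρ.toLocal v).toWeilGroupHom Φ : GL (Fin 1) (PadicAlgCl ℓ)) :
      Matrix (Fin 1) (Fin 1) (PadicAlgCl ℓ))) = (ι.symm a) • (1 : Matrix (Fin 1) (Fin 1) (PadicAlgCl ℓ)) := by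
    rw [matrix_fin_one_eq_trace_smul_one (((ρ.toLocal v).toWeilGroupHom Φ : GL (Fin 1) (PadicAlgCl ℓ)) :
      Matrix (Fin 1) (Fin 1) (PadicAlgCl ℓ)), FramedRep.toWeilGroupHom_apply, htrace']
  have hmatC : LinearMap.toMatrix' (rℂ.ρ Φ) = a • (1 : Matrix (Fin 1) (Fin 1) ℂ) := by
    rw [hmat, hM, Matrix.map_smul' _ _ _ (fun x y => map_mul (ι : PadicAlgCl ℓ →+* ℂ) x y),
      Matrix.map_one _ (map_zero _) (map_one _)]
    congr 1
    simp
  have : rℂ.ρ Φ = Matrix.toLin' (a • (1 : Matrix (Fin 1) (Fin 1) ℂ)) := by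
    rw [← hmatC, Matrix.toLin'_toMatrix']
  rw [this, map_smul, Matrix.toLin'_one]

/-! ### Assembly: local–global compatibility in rank one at the unramified places of `χ` -/

/-- Two uniformisers of `K_v` — one in the adelic normalisation `|ϖ|_v = exp(-1)`, one for the
canonical valuation of the local field `K_v` — differ by an element of the unit group `𝒪_vˣ`.
[folklore] -/
theorem mul_inv_mem_unitGroup_of_isUniformizer {v : HeightOneSpectrum (𝓞 K)}
    {ϖ ϖ' : (v.adicCompletion K)ˣ} (hϖ : Valued.v (ϖ : v.adicCompletion K) = WithZero.exp (-1 : ℤ))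
    (hϖ' : (ValuativeRel.valuation (v.adicCompletion K)).IsUniformizer (ϖ' : v.adicCompletion K)) :
    ϖ' * ϖ⁻¹ ∈ (ValuativeRel.valuation (v.adicCompletion K)).valuationSubring.unitGroup := by
  have hval : ValuativeRel.valuation (v.adicCompletion K) (ϖ : v.adicCompletion K) =
      ValuativeRel.valuation (v.adicCompletion K) (ϖ' : v.adicCompletion K) :=
    (isUniformizingElement_of_valued_eq K v hϖ).valuation_eq (isUniformizingElement_of_isUniformizer hϖ')
  have h0 : ValuativeRel.valuation (v.adicCompletion K) (ϖ : v.adicCompletion K) ≠ 0 :=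
    (Valuation.ne_zero_iff _).mpr ϖ.ne_zero
  rw [Valuation.mem_unitGroup_iff, Units.val_mul, Units.val_inv_eq_inv_val, map_mul, map_inv₀, ← hval,
    mul_inv_cancel₀ h0]

/-- **Rank one: the matching data at an unramified place of the Hecke character.**  Let `GL₁(𝔸_K)`
act on `π = W/W'` through `χ ∘ det` (mod `W'`), `χ` unramified at `v`, and let `ρ : Γ_K → GL₁(ℚ̄_ℓ)` be
Satake–Frobenius compatible with `π` at `v`.  Then `ρ` is
unramified at `v` and there are a local component `π_v = χ_v ∘ det` and a transport `rℂ` of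
`(ρ|_{W_{K_v}}, 0)` along `ι` with `rℂ ∈ rec_v(π_v)`: `rℂ` has `N = 0`, is unramified, and its
geometric Frobenii act by the Satake parameter `χ(ϖ_v)` (`rankOne_transport_frobenius`), which is
`χ_v(artin_v Φ)` because `artin_v Φ` is a uniformiser and `χ_v` is unramified
(`stub_rankOne_unramified_recGL_matching`). [cite: HarrisTaylorAMS2001, Thm. A (i)]
[cite: TateCorvallis1979, (4.1.3)–(4.2.1)] [cite: BuzzardGeeLMS2014, Conj. 3.2.1 and Rem. 3.2.5] -/
theorem rankOne_matching_of_satakeFrobCompatibleAt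
    {hcpt : isCompact_glFiniteIntegralLevel 1 K}
    (Rec : ReciprocityData K) (ι : PadicAlgCl ℓ ≃+* ℂ)
    (π : AutomorphicRepData (AutomorphyDatum.gl 1 K hcpt)) (χ : HeckeCharacter K)
    (hχ : ∀ (g : (AdelicGroupData.gl 1 K).Adelic), ∀ φ ∈ π.W,
      rightTranslation (AdelicGroupData.gl 1 K) g φ -
        ((χ (Matrix.GeneralLinearGroup.det g) : ℂˣ) : ℂ) • φ ∈ π.W')
    (ρ : FramedGaloisRep K (PadicAlgCl ℓ) 1) {v : HeightOneSpectrum (𝓞 K)} (hur : χ.IsUnramifiedAt v)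
    (hsat : SatakeFrobCompatibleAt ι π ρ v) :
    ∃ (hρ : ρ.IsUnramifiedAt v) (πv : SmoothIrrep (GL (Fin 1) (v.adicCompletion K)))
      (rℂ : WeilDeligneRep (v.adicCompletion K) ℂ (Fin 1 → ℂ)),
      π.HasLocalComponentAt v πv.ρ ∧
        (WeilDeligneRep.ofRep ((ρ.toLocal v).weilRestrict (v.adicCompletion K))
          (isLocallyUnramified_toLocal_of_isUnramifiedAt ρ v hρ).isUnramifiedRep_weilRestrict.isContinuousRep).IsTransportAlong
            (ι : PadicAlgCl ℓ →+* ℂ) rℂ ∧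
        rℂ.HasFrobSemisimpleClass ((Rec.llc v).recGL 1 (IrrClass.mk πv)) := by
  obtain ⟨α, hα, hρ, hcp⟩ := hsat
  obtain ⟨ϖ, hϖ, rfl⟩ := π.exists_eq_singleton_of_hasSatakeParamAt_glOne hχ hα
  set a : ℂ := ((χ (localUnits v ϖ) : ℂˣ) : ℂ) with ha
  have hcp' : ρ.HasFrobCharpolyAt v (X - C (ι.symm a)⁻¹) := by
    rw [arithFrobPolyOfSatake_one, Multiset.map_singleton, Multiset.prod_singleton, map_inv₀] at hcp
    exact hcp
  obtain ⟨χv, hχv, hχv1, hloc⟩ := stub_rankOne_hasLocalComponentAt_of_isUnramifiedAt K hcpt π χ hχ v hur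
  obtain ⟨rℂ, htr⟩ := exists_isTransportAlong (ι : PadicAlgCl ℓ →+* ℂ)
    (WeilDeligneRep.ofRep ((ρ.toLocal v).weilRestrict (v.adicCompletion K))
      (isLocallyUnramified_toLocal_of_isUnramifiedAt ρ v hρ).isUnramifiedRep_weilRestrict.isContinuousRep)
  obtain ⟨hN, hunr, hΦ⟩ := rankOne_transport_frobenius ι ρ v hρ a hcp' rℂ htr
  set L := Rec.llc v with hL
  obtain ⟨Φ, hΦdeg⟩ := WeilGroup.deg_surjective IsFrobPow.mul_holds IsFrobPow.unique_holds
    (exists_isFrobPow_holds (v.adicCompletion K)) (-1 : ℤ)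
  -- `a = χ_v(artin Φ)`: both `ϖ` and `artin Φ` are uniformisers, `χ_v` is unramified
  have hart : (ValuativeRel.valuation (v.adicCompletion K)).IsUniformizer
      (L.artin.artin Φ : v.adicCompletion K) := L.artin.artin_frob Φ hΦdeg
  have hkey : ((χv (L.artin.artin Φ) : ℂˣ) : ℂ) = a := by
    have hu := hχv1 _ (mul_inv_mem_unitGroup_of_isUniformizer hϖ hart)
    have h1 : χv (L.artin.artin Φ) = χv ϖ := by
      have : L.artin.artin Φ = (L.artin.artin Φ * ϖ⁻¹) * ϖ := by group
      rw [this, map_mul, hu, one_mul]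
    rw [h1, hχv, HeckeCharacter.localComponent_apply]
  refine ⟨hρ, SmoothIrrep.ofQuasiChar χv, rℂ, hloc, htr, ?_⟩
  exact stub_rankOne_unramified_recGL_matching (v.adicCompletion K) L χv hχv1 rℂ hN hunr
    ⟨Φ, hΦdeg, by rw [hΦ Φ hΦdeg, hkey]⟩


/-- **Rank one: local–global compatibility at every unramified place of `χ` where `ρ` is
Satake–Frobenius compatible, for EVERY reciprocity datum** (under
`FontaineDatumExists` at `v ∣ ℓ`, unconditionally at `v ∤ ℓ`).  Assembles the matching data
(`rankOne_matching_of_satakeFrobCompatibleAt`) with the unramified-sector reductions of the summit's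
clause: c4 `localGlobalCompatibleAt_away_of_isUnramifiedAt` (+ the inertia character
`WeilGroup.exists_inertiaCharacter_ne_one_top`) at `v ∤ ℓ`, c3
`localGlobalCompatibleAt_above_of_isUnramifiedAt` ((F8)) at `v ∣ ℓ`.
[cite: BuzzardGeeLMS2014, Conj. 3.2.1–3.2.2 (n = 1)] [cite: TateCorvallis1979, (4.2.1)]
[cite: FontaineAsterisque223VIII, §2.3.7] -/
theorem rankOne_localGlobalCompatibleAt_of_satakeFrobCompatibleAt
    (hF : FontaineDatumExists) {hcpt : isCompact_glFiniteIntegralLevel 1 K}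
    (Rec : ReciprocityData K) (ι : PadicAlgCl ℓ ≃+* ℂ)
    (π : AutomorphicRepData (AutomorphyDatum.gl 1 K hcpt)) (χ : HeckeCharacter K)
    (hχ : ∀ (g : (AdelicGroupData.gl 1 K).Adelic), ∀ φ ∈ π.W,
      rightTranslation (AdelicGroupData.gl 1 K) g φ -
        ((χ (Matrix.GeneralLinearGroup.det g) : ℂˣ) : ℂ) • φ ∈ π.W')
    (ρ : FramedGaloisRep K (PadicAlgCl ℓ) 1) {v : HeightOneSpectrum (𝓞 K)} (hur : χ.IsUnramifiedAt v)
    (hsat : SatakeFrobCompatibleAt ι π ρ v) :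
    LocalGlobalCompatibleAt Rec ι π ρ v := by
  obtain ⟨hρ, πv, rℂ, hloc, htr, hcls⟩ :=
    rankOne_matching_of_satakeFrobCompatibleAt Rec ι π χ hχ ρ hur hsat
  by_cases hv : ((ℓ : ℕ) : 𝓞 K) ∈ v.asIdeal
  · exact localGlobalCompatibleAt_above_of_isUnramifiedAt hF Rec ι π ρ hv hρ πv hloc rℂ htr hcls
  · exact localGlobalCompatibleAt_away_of_isUnramifiedAt Rec ι π ρ hv hρ
      (WeilGroup.exists_inertiaCharacter_ne_one_top (F := v.adicCompletion K) (PadicAlgCl ℓ))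
      πv hloc rℂ htr hcls

/-- **Rank one: `Corresponds` reduces to the bad places.**  For `π` with Hecke character `χ` and
`ρ` Satake–Frobenius compatible with `π` almost everywhere, `Corresponds Rec ι π ρ` holds as soon as
local–global compatibility is known at the places where `χ` is ramified or `ρ` is not
Satake–Frobenius compatible with `π` — a finite set for the `ℓ`-adic avatar of a finite-order `χ`
(`HeckeCharacter.exists_lAdic_of_isFiniteOrder`).  Those are exactly the places where the tree's
non-unique `LocalArtinData` (blocker B2: `rec_v(χ_v) = χ_v ∘ artin_v` for an ARBITRARY local Artin
datum) forbids a proof for every `Rec`. [cite: BuzzardGeeLMS2014, Conj. 3.2.1–3.2.2 (n = 1)]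
[cite: TateCorvallis1979, (4.2.1)] -/
theorem rankOne_corresponds_of_bad_places
    (hF : FontaineDatumExists) {hcpt : isCompact_glFiniteIntegralLevel 1 K}
    (Rec : ReciprocityData K) (ι : PadicAlgCl ℓ ≃+* ℂ)
    (π : AutomorphicRepData (AutomorphyDatum.gl 1 K hcpt)) (χ : HeckeCharacter K)
    (hχ : ∀ (g : (AdelicGroupData.gl 1 K).Adelic), ∀ φ ∈ π.W,
      rightTranslation (AdelicGroupData.gl 1 K) g φ -
        ((χ (Matrix.GeneralLinearGroup.det g) : ℂˣ) : ℂ) • φ ∈ π.W')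
    (ρ : FramedGaloisRep K (PadicAlgCl ℓ) 1)
    (hae : ∀ᶠ v : HeightOneSpectrum (𝓞 K) in cofinite, SatakeFrobCompatibleAt ι π ρ v)
    (hbad : ∀ v : HeightOneSpectrum (𝓞 K), ¬ (χ.IsUnramifiedAt v ∧ SatakeFrobCompatibleAt ι π ρ v) →
      LocalGlobalCompatibleAt Rec ι π ρ v) :
    Corresponds Rec ι π ρ := by
  refine ⟨hae, fun v => ?_⟩
  by_cases h : χ.IsUnramifiedAt v ∧ SatakeFrobCompatibleAt ι π ρ v
  · exact rankOne_localGlobalCompatibleAt_of_satakeFrobCompatibleAt hF Rec ι π χ hχ ρ h.1 h.2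
  · exact hbad v h


/-- **Registered stub `stub_rankOne_localGlobalCompatibleAt_of_satakeFrobCompatibleAt` of line `Sketch`
(crux stmt-Langlands-14328), closed form of `rankOne_localGlobalCompatibleAt_of_satakeFrobCompatibleAt`**:
in rank one, for EVERY reciprocity datum, local–global compatibility holds at every place where the
Hecke character of `π` is unramified and `ρ` is Satake–Frobenius compatible with `π` (under
`FontaineDatumExists`, used at `v ∣ ℓ` only). [cite: BuzzardGeeLMS2014, Conj. 3.2.1–3.2.2 (n = 1)]
[cite: TateCorvallis1979, (4.2.1)] -/
theorem stub_rankOne_localGlobalCompatibleAt_of_satakeFrobCompatibleAt :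
    FontaineDatumExists → ∀ (K : Type) [Field K] [NumberField K] (ℓ : ℕ) [Fact ℓ.Prime]
      (hcpt : isCompact_glFiniteIntegralLevel 1 K) (Rec : ReciprocityData K) (ι : PadicAlgCl ℓ ≃+* ℂ)
      (π : AutomorphicRepData (AutomorphyDatum.gl 1 K hcpt)) (χ : HeckeCharacter K),
      (∀ (g : (AdelicGroupData.gl 1 K).Adelic), ∀ φ ∈ π.W,
        rightTranslation (AdelicGroupData.gl 1 K) g φ -
          ((χ (Matrix.GeneralLinearGroup.det g) : ℂˣ) : ℂ) • φ ∈ π.W') →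
      ∀ (ρ : FramedGaloisRep K (PadicAlgCl ℓ) 1) (v : HeightOneSpectrum (𝓞 K)),
        χ.IsUnramifiedAt v → SatakeFrobCompatibleAt ι π ρ v → LocalGlobalCompatibleAt Rec ι π ρ v :=
  fun hF _ _ _ _ _ _ Rec ι π χ hχ ρ _ hur hsat =>
    rankOne_localGlobalCompatibleAt_of_satakeFrobCompatibleAt hF Rec ι π χ hχ ρ hur hsat

end RankOne

end Summit.Langlands.Langlands.Theorems.ReciprocityUpToIrreducibility

end
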